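import Summits.BirchSwinnertonDyer.BirchSwinnertonDyer.Theorems.ByReductionTypeAtTwoAdditivePotGoodLowerHalfT0ClassLiftA
import Summits.BirchSwinnertonDyer.BirchSwinnertonDyer.Theorems.ByReductionTypeAtTwoAdditivePotGoodLowerHalfT0NarrowRankStampsD
import HarnessLib

/-!
# K4 crux `AdditiveRankZeroAtTwo` (19098), child C3″ `AdditivePotGoodLowerHalfAtTwo` (item 22617): C3″ RUNGS of the TWO-PRIME `Δ_cubic > 0` rows `174920h1` with the
# print binder `hLim2` (LIM35@2-REAL) REPLACED by ONE displayed narrow-rank equality (file D of the `NarrowRankRungs` series A–C; stamps in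
# `…LowerHalfT0NarrowRankStampsD`; seat `bsd-2adic-k4-w2` GEN 11; `--supports stmt-BirchSwinnertonDyer-22617 --as helper`)

Cell `bsd-2adic`. Per row: `conjA_two_<L>_of_narrowRankEq₀₁_kernelLit` (model transport of the stamp `AddKatoTwo.conjA_two_<L>_of_narrowRankEq₀₁ hθ hnr` to the Cremona
literal model) and GEN 3's rungs re-keyed — `AddPotGoodInstances.bsdp_two_<L>_narrowRankEq`, `bsdp_two_of_isIsogenous_<L>_narrowRankEq`: BSD₂ on the class ⟸ PRINT
{hSharp (reading), hGZK, hmod, hCT(, hCassels)} + RECORD {r_an = 0, #Ш_an = q, ord₂ q ≤ 6} + the two VALUED Selmer slots + `hnr` (ONE equality of narrow `2`-ranks of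
`ℚ(θ)·ℚ₁` and `ℚ(θ)` along every cyclotomic `ℤ₂`-extension of `ℚ(θ)`; instrument tier, UNVALUED at landing — kit owed). Compared with GEN 8's `…_of_lim2` rungs the
print binder `hLim2` is GONE.

HONEST FRAMING (D-0036 / D-0054 / D-0152): conditional theorems; closes nothing at the `∀`-level (C3″ 22617 / C1″ 22615 OPEN); nothing booked (D-0054); no rung moves;
BSD is not proved by any of this. THEOREMS ONLY (no `def`).

References: [Kato2004Asterisque] Thm. 12.5 (1)(3), 13.8, 14.14; [Fukuda1994] Thm. 1 (2); [CoatesSujatha2005] (A); [Cassels1965ArithmeticVIII] Thm. 1.3; [Miller2011LMS] Def. 1.1.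
-/

set_option autoImplicit false
-- the Theorems namespace of this sub repeats the summit name by design (D-0017 nested layout)
set_option linter.dupNamespace false

noncomputable section

open scoped Classical IntermediateField NumberField Real nonZeroDivisors

namespace Summit.BirchSwinnertonDyer.BirchSwinnertonDyer.Theorems.AddPotGoodInstances

open WeierstrassCurve Polynomial Literature.NumberTheory.EllipticCurves
  Literature.NumberTheory.IwasawaTheory
  Literature.NumberTheory.NumberFields
  Literature.NumberTheory.EllipticCurves.Rank1Residual
  Literature.NumberTheory.EllipticCurves.Rank1Residual.Typed
  Summit.BirchSwinnertonDyer.Rank1Residual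
  Summit.BirchSwinnertonDyer.Rank1Residual.Additive
  Summit.BirchSwinnertonDyer.BirchSwinnertonDyer.Theorems

/-- Model transport for (A) at `2` in the `∃ γ D` spelling (the statement only depends on the Weierstrass CURVE).
[cite: CoatesSujatha2005, statement (A)] -/
private theorem conjA_two_of_eq'' {W W' : WeierstrassCurve ℚ} (h : W' = W)
    (H : ∀ (κ : ZpExtension ℚ 2), κ.IsCyclotomic →
      ∃ (γ : Field.absoluteGaloisGroup ℚ) (D : W'.FineSelmerDualData κ γ), Module.Finite ℤ_[2] (RestrictScalars ℤ_[2] (IwasawaAlgebra 2) D.X)) :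
    ∀ (κ : ZpExtension ℚ 2), κ.IsCyclotomic →
      ∃ (γ : Field.absoluteGaloisGroup ℚ) (D : W.FineSelmerDualData κ γ), Module.Finite ℤ_[2] (RestrictScalars ℤ_[2] (IwasawaAlgebra 2) D.X) := by
  subst h; exact H

/-! ## Row `174920h1` (Δ_cubic > 0, `2` split; stamp `AddKatoTwo.conjA_two_174920h1_of_narrowRankCert` of the stamps file, GENERAL layer pair) -/

/-- **(A) at `(174920h1, 2)` for the Cremona model from a displayed narrow rank certificate (layer pair `n / n+1`, bound `B`), NO print fact**: the stamp transported
from its cast model to the literal model. [cite: CoatesSujatha2005, statement (A)] -/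
theorem conjA_two_174920h1_of_narrowRankCert_kernelLit
    {θ : AlgebraicClosure ℚ} (hθ : aeval θ (Cubic.toPoly ⟨1, ((-1 : ℤ) : ℚ), ((-30 : ℤ) : ℚ), ((40 : ℤ) : ℚ)⟩) = 0)
    (n B : ℕ)
    (hcert : haveI : FiniteDimensional ℚ (IntermediateField.adjoin ℚ {θ}) :=
        IntermediateField.adjoin.finiteDimensional ((AlgebraicClosure.isAlgebraic ℚ).isAlgebraic θ).isIntegral
      haveI : NumberField (IntermediateField.adjoin ℚ {θ}) := NumberField.mk
      ∀ κL : ZpExtension (IntermediateField.adjoin ℚ {θ}) 2, κL.IsCyclotomic →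
        (∀ [NumberField ↥(κL.layer n)] [NumberField ↥(κL.layer (n + 1))],
          (powMonoidHom (α := NarrowClassGroup ↥(κL.layer (n + 1))) 2).range.index =
            (powMonoidHom (α := NarrowClassGroup ↥(κL.layer n)) 2).range.index) ∧
        (∀ m : ℕ, m ≤ n → ∀ [NumberField ↥(κL.layer m)],
          padicValNat 2 (powMonoidHom (α := NarrowClassGroup ↥(κL.layer m)) 2).range.index ≤ B))
    :
    haveI := isElliptic_174920h1
    ∀ (κ : ZpExtension ℚ 2), κ.IsCyclotomic →
      ∃ (γ : Field.absoluteGaloisGroup ℚ) (D : (⟨0, 0, 0, -717514194247, -233934275882300614⟩ : WeierstrassCurve ℚ).FineSelmerDualData κ γ),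
        Module.Finite ℤ_[2] (RestrictScalars ℤ_[2] (IwasawaAlgebra 2) D.X) :=
  conjA_two_of_eq'' (W' := (⟨0, ((0 : ℤ) : ℚ), 0, ((-717514194247 : ℤ) : ℚ), ((-233934275882300614 : ℤ) : ℚ)⟩ : WeierstrassCurve ℚ)) (by norm_num) (fun κ hκ ↦ AddKatoTwo.conjA_two_174920h1_of_narrowRankCert hθ n B hcert κ hκ)

/-- **`BSD₂(174920h1)` with (A) from a displayed narrow rank certificate and NO print fact for (A)** — the FIRST BSD₂ rung of this class whose (A)₂ input is not the bare
hypothesis `hA`: GEN 3's rung `bsdp_two_174920h1_of_conjA` with `hA` from `conjA_two_174920h1_of_narrowRankCert_kernelLit hθ n B hcert`. Conditional on PRINT {`hSharp` (reading), `hGZK`,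
`hmod`, `hCT`}, the RECORD `hr`, `#Ш_an = q` (`ord₂ q ≤ 6`), the two VALUED slots and the (unvalued) instrument certificate `hcert`. Nothing booked; BSD is not proved by this.
[cite: Kato2004Asterisque, Thm. 12.5 (1)(3), 13.8, 14.14] [cite: Fukuda1994, Thm. 1 (2)] [cite: Miller2011LMS, Def. 1.1] -/
theorem bsdp_two_174920h1_narrowRankCert
    (hSharp : Kato2004.rankZero_padicValNat_sha_add_padicValNat_tamagawa_le_at_two_of_irreducible_of_fineSelmerDual_fg)
    (hGZK : rank_eq_analyticRank_of_analyticRank_le_one) (hmod : hasEntireLFunction_rat)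
    (hCT : exists_casselsTate_pairing (K := ℚ))
    {θ : AlgebraicClosure ℚ} (hθ : aeval θ (Cubic.toPoly ⟨1, ((-1 : ℤ) : ℚ), ((-30 : ℤ) : ℚ), ((40 : ℤ) : ℚ)⟩) = 0)
    (n B : ℕ)
    (hcert : haveI : FiniteDimensional ℚ (IntermediateField.adjoin ℚ {θ}) :=
        IntermediateField.adjoin.finiteDimensional ((AlgebraicClosure.isAlgebraic ℚ).isAlgebraic θ).isIntegral
      haveI : NumberField (IntermediateField.adjoin ℚ {θ}) := NumberField.mk
      ∀ κL : ZpExtension (IntermediateField.adjoin ℚ {θ}) 2, κL.IsCyclotomic →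
        (∀ [NumberField ↥(κL.layer n)] [NumberField ↥(κL.layer (n + 1))],
          (powMonoidHom (α := NarrowClassGroup ↥(κL.layer (n + 1))) 2).range.index =
            (powMonoidHom (α := NarrowClassGroup ↥(κL.layer n)) 2).range.index) ∧
        (∀ m : ℕ, m ≤ n → ∀ [NumberField ↥(κL.layer m)],
          padicValNat 2 (powMonoidHom (α := NarrowClassGroup ↥(κL.layer m)) 2).range.index ≤ B))
    (hr : haveI := isElliptic_174920h1; (⟨0, 0, 0, -717514194247, -233934275882300614⟩ : WeierstrassCurve ℚ).analyticRank = 0)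
    (hs₁ : Nat.card ((⟨0, 0, 0, -717514194247, -233934275882300614⟩ : WeierstrassCurve ℚ).selmerGroup (2 ^ 2)) = 2 ^ 4)
    (hs₂ : Nat.card ((⟨0, 0, 0, -717514194247, -233934275882300614⟩ : WeierstrassCurve ℚ).selmerGroup (2 ^ (2 + 1))) = 2 ^ 6)
    {q : ℚ} (hq : haveI := isElliptic_174920h1; shaAn (⟨0, 0, 0, -717514194247, -233934275882300614⟩ : WeierstrassCurve ℚ) = (q : ℂ)) (hv : padicValRat 2 q ≤ 6) :
    haveI := isElliptic_174920h1; haveI := isGloballyMinimal_174920h1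
    BSDp (⟨0, 0, 0, -717514194247, -233934275882300614⟩ : WeierstrassCurve ℚ) 2 := by
  exact bsdp_two_174920h1_of_conjA hSharp hGZK hmod hCT (conjA_two_174920h1_of_narrowRankCert_kernelLit hθ n B hcert) hr hs₁ hs₂ hq hv

/-- **`BSD₂` ON THE WHOLE CLASS of `174920h1` with (A) from a displayed narrow rank certificate and NO print fact for (A)**: GEN 3's class rung (Cassels transport
`hCassels`) with `hA` from `conjA_two_174920h1_of_narrowRankCert_kernelLit hθ n B hcert`. Nothing booked; BSD is not proved by this.
[cite: Cassels1965ArithmeticVIII, Thm. 1.3] [cite: Kato2004Asterisque, Thm. 12.5 (1)(3)] [cite: Fukuda1994, Thm. 1 (2)] -/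
theorem bsdp_two_of_isIsogenous_174920h1_narrowRankCert
    (hSharp : Kato2004.rankZero_padicValNat_sha_add_padicValNat_tamagawa_le_at_two_of_irreducible_of_fineSelmerDual_fg)
    (hGZK : rank_eq_analyticRank_of_analyticRank_le_one) (hmod : hasEntireLFunction_rat)
    (hCT : exists_casselsTate_pairing (K := ℚ)) (hCassels : bsdRHS_eq_of_isIsogenous)
    {θ : AlgebraicClosure ℚ} (hθ : aeval θ (Cubic.toPoly ⟨1, ((-1 : ℤ) : ℚ), ((-30 : ℤ) : ℚ), ((40 : ℤ) : ℚ)⟩) = 0)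
    (n B : ℕ)
    (hcert : haveI : FiniteDimensional ℚ (IntermediateField.adjoin ℚ {θ}) :=
        IntermediateField.adjoin.finiteDimensional ((AlgebraicClosure.isAlgebraic ℚ).isAlgebraic θ).isIntegral
      haveI : NumberField (IntermediateField.adjoin ℚ {θ}) := NumberField.mk
      ∀ κL : ZpExtension (IntermediateField.adjoin ℚ {θ}) 2, κL.IsCyclotomic →
        (∀ [NumberField ↥(κL.layer n)] [NumberField ↥(κL.layer (n + 1))],
          (powMonoidHom (α := NarrowClassGroup ↥(κL.layer (n + 1))) 2).range.index =
            (powMonoidHom (α := NarrowClassGroup ↥(κL.layer n)) 2).range.index) ∧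
        (∀ m : ℕ, m ≤ n → ∀ [NumberField ↥(κL.layer m)],
          padicValNat 2 (powMonoidHom (α := NarrowClassGroup ↥(κL.layer m)) 2).range.index ≤ B))
    {W : WeierstrassCurve ℚ} [W.IsElliptic] [W.IsGloballyMinimal]
    (hiso : haveI := isElliptic_174920h1; IsIsogenous W (⟨0, 0, 0, -717514194247, -233934275882300614⟩ : WeierstrassCurve ℚ)) (hr : W.analyticRank = 0)
    (hs₁ : Nat.card ((⟨0, 0, 0, -717514194247, -233934275882300614⟩ : WeierstrassCurve ℚ).selmerGroup (2 ^ 2)) = 2 ^ 4)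
    (hs₂ : Nat.card ((⟨0, 0, 0, -717514194247, -233934275882300614⟩ : WeierstrassCurve ℚ).selmerGroup (2 ^ (2 + 1))) = 2 ^ 6)
    {q : ℚ} (hq : haveI := isElliptic_174920h1; shaAn (⟨0, 0, 0, -717514194247, -233934275882300614⟩ : WeierstrassCurve ℚ) = (q : ℂ)) (hv : padicValRat 2 q ≤ 6) :
    BSDp W 2 := by
  exact bsdp_two_of_isIsogenous_174920h1_of_conjA hSharp hGZK hmod hCT hCassels (conjA_two_174920h1_of_narrowRankCert_kernelLit hθ n B hcert) hiso hr hs₁ hs₂ hq hv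

end Summit.BirchSwinnertonDyer.BirchSwinnertonDyer.Theorems.AddPotGoodInstances

end
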